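import Literature.AlgebraicGeometry.Frobenioids.DivisorialDescriptionsAPairs
import HarnessLib

/-!
# Frobenioids I, Theorem 5.1 (i): the bijection `Pic_Φ(A) ⥲ Pic_C(A)` — proof

Mochizuki, *The geometry of Frobenioids I: the general theory*, Kyushu J. Math. **62** (2008)
293–400, §5, Theorem 5.1 (i), kurims text p. 96 (statement), pp. 97–99 (proof)
[cite: MochizukiFrdI2008, Thm. 5.1 (i) pp.96-99].

This file DISCHARGES the named statement `PreFrobenioid.Thm51i F A` of
`DivisorialDescriptions.lean` (abc-iut-L1-t5): `thm51i_holds`, on top of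
`DivisorialDescriptionsAPairs.lean` (surjectivity onto `Pic_Φ(A)` and `Pic_C(A)`; same class in
`Pic_C(A)` ⟹ same class in `Pic_Φ(A)`). Here:
* `A`-pairs with the same class in `Pic_Φ(A)` have the same class in `Pic_C(A)` (pp. 97–98): by
  `BiratGerms.lean` the difference of the classes is a SINGLE germ `(δ₁, δ₂)` at `A`; refining
  `φ, φ', δ₁, δ₂` to a common domain `E` produces pre-steps `E → C`, `E → C'` with EQUAL zero divisors and
  compatible projections, whence an isomorphism `C ⥲ C'` over `A_D` by Definition 1.3 (iii)(d) (coslice)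
  and total epimorphicity (`toIsomOver_eq_of_mk_cls_eq`; this common-refinement argument replaces the
  printed diagram with `δ†`, `ε`, `F`);
* the "Moreover" on morphisms of Frobenius type (`APair.cls_eq_pow`, `mk_cls_pushforward`): factor
  `F_d ∘ φ` and `κ ∘ ψ` through morphisms of Frobenius type of degree `d` (Definition 1.3 (iv)(a),
  (ii)); the resulting `A`-pair has divisor class exactly `d` times the original (Remark 1.1.1) —
  the printed "commutative diagrams as in Proposition 1.10 (i)";
* the assembly `thm51i_holds : Thm51i F A`.
Theorems only; no statement of `DivisorialDescriptions.lean` is altered.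
-/

namespace Literature.AlgebraicGeometry.Frobenioids

open CategoryTheory Opposite

universe w v v' u u'

namespace PreFrobenioid

variable {D : Type u} [Category.{v} D] {Φ : Dᵒᵖ ⥤ CommMonCat.{w}}
  {C : Type u'} [Category.{v'} C] (F : C ⥤ ElemFrobenioid Φ)

/-! ### Same class in `Pic_Φ(A)` ⟹ same class in `Pic_C(A)` -/

/-- If two `A`-pairs `p = (φ, ψ)`, `q = (φ', ψ')` have the same class in `Pic_Φ(A)`, the attached
objects of `C ×_D D^isom_{A_D}` are isomorphic (proof of Thm. 5.1 (i), pp. 97–98). By `BiratGerms` the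
difference of the classes is one germ `(δ₁, δ₂)` at `A`; a common refinement `E` of `φ, φ', δ₁, δ₂`
(Definition 1.3 (iii)(d) over `A`) yields pre-steps `E → C`, `E → C'` with equal zero divisors and
compatible projections to `D`, hence mutually inverse co-angular pre-steps `C ⇄ C'` under `E`
(Definition 1.3 (iii)(d), coslice; total epimorphicity). [cite: MochizukiFrdI2008, Thm. 5.1 (i) p.98] -/
theorem toIsomOver_eq_of_mk_cls_eq (hF : IsFrobenioid F) (hiso : IsOfIsotropicType F) {A : C}
    {p q : APair F A}
    (h : (QuotientGroup.mk p.cls : (biratSubfunctor F).Pic (baseObj F A)) = QuotientGroup.mk q.cls) :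
    (⟦p.toIsomOver⟧ : PicC F (baseObj F A)) = ⟦q.toIsomOver⟧ := by
  haveI : IsIso (Base F p.fst) := p.isPreStep_fst.2
  haveI : IsIso (Base F q.fst) := q.isPreStep_fst.2
  haveI : IsIso (Base F p.snd) := p.isPreStep_snd.2
  haveI : IsIso (Base F q.snd) := q.isPreStep_snd.2
  -- the difference of the classes is a single germ `(δ₁, δ₂)` at `A`
  obtain ⟨Y, δ₁, δ₂, hδ₁, hδ₂, hb, hgerm⟩ :=
    mem_biratGerms_of_mem_biratSubfunctor F hF hiso (QuotientGroup.eq_iff_div_mem.mp h)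
  haveI : IsIso (Base F δ₁) := hδ₁.2.2
  haveI : IsCancelMul (Φ.obj (op (baseObj F Y))) := isIntegral_iff_isCancelMul.mp
    (hF.isPreFrobenioid.isDivisorial (baseObj F Y)).isPreDivisorial.isIntegral
  -- common refinement `ω : E → A` of `φ, φ', δ₁, δ₂`, through `δ₁`
  obtain ⟨E, ω, hω, hωdiv⟩ := hF.iii_d_over_surj A (invDiv F δ₁ hδ₁.2.2 *
    (invDiv F p.fst p.isPreStep_fst.2 * (invDiv F q.fst q.isPreStep_fst.2 * invDiv F δ₂ hδ₂.2)))
  obtain ⟨a₁, ha₁, ha₁ω⟩ := hF.iii_d_over_full ω δ₁ hω hδ₁ (by rw [hωdiv]; exact dvd_mul_right _ _)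
  have hp₁ : IsPreStep F (a₁ ≫ δ₁) := IsPreStep.comp F ha₁.2 hδ₁.2
  have hp₂ : IsPreStep F (a₁ ≫ δ₂) := IsPreStep.comp F ha₁.2 hδ₂
  have hs : invDiv F a₁ ha₁.2.2 = pull Φ (Base F δ₁)
      (invDiv F p.fst p.isPreStep_fst.2 * (invDiv F q.fst q.isPreStep_fst.2 * invDiv F δ₂ hδ₂.2)) := by
    have e := pull_invDiv_comp F a₁ δ₁ ha₁.2.2 hδ₁.2 hp₁.2
    rw [RatFrac.invDiv_congr F ha₁ω hp₁.2 hω.2.2, hωdiv, map_mul, pull_invDiv] at e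
    exact (mul_left_cancel e).symm
  have hdiv₂ : invDiv F (a₁ ≫ δ₂) hp₂.2 = invDiv F δ₂ hδ₂.2 *
      (invDiv F p.fst p.isPreStep_fst.2 * (invDiv F q.fst q.isPreStep_fst.2 * invDiv F δ₂ hδ₂.2)) := by
    haveI : IsIso (Base F δ₂) := hδ₂.2
    apply pull_injective (Base F δ₂)
    rw [pull_invDiv_comp F a₁ δ₂ ha₁.2.2 hδ₂ hp₂.2, hs, show Base F δ₁ = Base F δ₂ from hb]
    simp only [map_mul, pull_invDiv]
  have hbω : Base F (a₁ ≫ δ₂) = Base F ω := by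
    rw [base_comp, ← show Base F δ₁ = Base F δ₂ from hb, ← base_comp, ha₁ω]
  -- `η : E → B` through `φ` over `a₁ ≫ δ₂`, `η' : E → B'` through `φ'` over `ω`
  obtain ⟨η, hη, hηω⟩ := hF.iii_d_over_full (a₁ ≫ δ₂) p.fst (isCoAngularPreStep_of_isotropic hiso hp₂)
    (isCoAngularPreStep_of_isotropic hiso p.isPreStep_fst)
    (by
      show invDiv F p.fst p.isPreStep_fst.2 ∣ invDiv F (a₁ ≫ δ₂) hp₂.2
      rw [hdiv₂]; exact (dvd_mul_right _ _).mul_left _)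
  obtain ⟨η', hη', hη'ω⟩ := hF.iii_d_over_full ω q.fst hω
    (isCoAngularPreStep_of_isotropic hiso q.isPreStep_fst)
    (by rw [hωdiv]; exact ((dvd_mul_right _ _).mul_left _).mul_left _)
  have he : IsPreStep F (η ≫ p.snd) := IsPreStep.comp F hη.2 p.isPreStep_snd
  have he' : IsPreStep F (η' ≫ q.snd) := IsPreStep.comp F hη'.2 q.isPreStep_snd
  -- the two pre-steps `E → C`, `E → C'` have the same zero divisor
  haveI : IsCancelMul (Φ.obj (op (baseObj F E))) := isIntegral_iff_isCancelMul.mp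
    (hF.isPreFrobenioid.isDivisorial (baseObj F E)).isPreDivisorial.isIntegral
  have hg : Algebra.GrothendieckGroup.of (invDiv F ω hω.2.2) /
      Algebra.GrothendieckGroup.of (invDiv F (a₁ ≫ δ₂) hp₂.2) = p.cls / q.cls := by
    rw [hgerm, ← germ_comp_eq F a₁ δ₁ δ₂ ha₁.2.2 hδ₁.2 hδ₂ hb hp₁.2 hp₂.2, RatFrac.invDiv_congr F ha₁ω hp₁.2 hω.2.2]
  have hDiv : Div F (η ≫ p.snd) = Div F (η' ≫ q.snd) := by
    apply Algebra.GrothendieckGroup.of_injective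
    rw [APair.of_div_comp_snd F p η, APair.of_div_comp_snd F q η', hηω, hη'ω, hbω,
      ← pull_invDiv (a₁ ≫ δ₂) hp₂.2, ← pull_invDiv ω hω.2.2, hbω, ← pullGp_of', ← pullGp_of', ← map_mul,
      ← map_mul, mul_comm q.cls]
    rw [div_eq_div_iff_mul_eq_mul] at hg
    exact congrArg _ hg.symm
  -- mutually inverse pre-steps `C ⇄ C'` under `E`
  obtain ⟨u, hu, heu⟩ := hF.iii_d_under_full (η ≫ p.snd) (η' ≫ q.snd)
    (isCoAngularPreStep_of_isotropic hiso he) (isCoAngularPreStep_of_isotropic hiso he') (by rw [hDiv])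
  obtain ⟨v, hv, hev⟩ := hF.iii_d_under_full (η' ≫ q.snd) (η ≫ p.snd)
    (isCoAngularPreStep_of_isotropic hiso he') (isCoAngularPreStep_of_isotropic hiso he) (by rw [hDiv])
  haveI := hF.isPreFrobenioid.isTotallyEpimorphic.epi (η ≫ p.snd)
  haveI := hF.isPreFrobenioid.isTotallyEpimorphic.epi (η' ≫ q.snd)
  have huv : u ≫ v = 𝟙 _ := by
    rw [← cancel_epi (η ≫ p.snd), ← Category.assoc, heu, hev, Category.comp_id]
  have hvu : v ≫ u = 𝟙 _ := by
    rw [← cancel_epi (η' ≫ q.snd), ← Category.assoc, hev, heu, Category.comp_id]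
  haveI : IsIso (Base F (η ≫ p.snd)) := he.2
  refine Quotient.sound ⟨⟨u, v, huv, hvu⟩, ?_⟩
  show Base F u ≫ (inv (Base F q.snd) ≫ Base F q.fst) = inv (Base F p.snd) ≫ Base F p.fst
  rw [← cancel_epi (Base F (η ≫ p.snd))]
  conv_lhs => rw [← Category.assoc, ← base_comp, heu, base_comp, Category.assoc,
    IsIso.hom_inv_id_assoc, ← base_comp, hη'ω]
  conv_rhs => rw [base_comp, Category.assoc, IsIso.hom_inv_id_assoc, ← base_comp, hηω, hbω]

/-! ### Morphisms of Frobenius type multiply classes by the Frobenius degree -/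

/-- Two `A`-pairs `p = (φ, ψ)` and `r = (φ₁, ψ₁)` related by a morphism of Frobenius type
`γ : B → B₁` of degree `d` through `φ₁ ∘ γ = F ∘ φ` (`F` an isometric base-identity endomorphism of `A` of
degree `d`) and `ψ₁ ∘ γ = κ ∘ ψ` (`κ` isometric of degree `d`) have classes `cls(r) = d · cls(p)`
(Remark 1.1.1: divisors are multiplied by `d`, projections unchanged). The "commutative diagrams as
in Proposition 1.10 (i)" of the printed proof. [cite: MochizukiFrdI2008, Thm. 5.1 (i) p.99] -/
theorem APair.cls_eq_pow {A : C} (p r : APair F A) (γ : p.src ⟶ r.src) (hγ : IsFrobeniusType F γ)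
    (z : A ⟶ A) (hz : IsBaseIdentity F z) (hzi : IsIsometry F z) (hpz : γ ≫ r.fst = p.fst ≫ z)
    (κ : p.tgt ⟶ r.tgt) (hκi : IsIsometry F κ) (hdκ : degFr F κ = degFr F γ)
    (hdz : degFr F z = degFr F γ) (hpk : γ ≫ r.snd = p.snd ≫ κ) :
    r.cls = p.cls ^ (degFr F γ : ℕ) := by
  haveI : IsIso (Base F (γ ≫ r.fst)) := IsBaseIso.comp F hγ.2 r.isPreStep_fst.2
  have hB : Base F (γ ≫ r.fst) = Base F p.fst := by
    rw [hpz, base_comp, show Base F z = 𝟙 _ from hz, Category.comp_id]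
  have hD1 : pull Φ (Base F γ) (Div F r.snd) = Div F p.snd ^ (degFr F γ : ℕ) := by
    have e := congrArg (Div F) hpk
    rw [div_comp, div_comp, show Div F γ = 1 from hγ.1.2, one_pow, mul_one,
      show Div F κ = 1 from hκi, map_one, one_mul, hdκ] at e
    exact e
  have hD2 : pull Φ (Base F γ) (Div F r.fst) = Div F p.fst ^ (degFr F γ : ℕ) := by
    have e := congrArg (Div F) hpz
    rw [div_comp, div_comp, show Div F γ = 1 from hγ.1.2, one_pow, mul_one,
      show Div F z = 1 from hzi, map_one, one_mul, hdz] at e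
    exact e
  apply pullGp_injective (Base F (γ ≫ r.fst))
  rw [map_pow]
  conv_lhs => rw [base_comp, pullGp_comp, APair.pullGp_cls, map_div, pullGp_of', pullGp_of', hD1, hD2,
    map_pow, map_pow]
  conv_rhs => rw [hB, APair.pullGp_cls]
  rw [div_pow]

/-- **Theorem 5.1 (i), "Moreover"**: pushing `(C, ζ)` forward along a morphism of Frobenius type
`κ : C → C'` multiplies the corresponding class of `Pic_Φ(A)` by `deg_Fr(κ)`. Construction: with
`F_d` the base-identity Frobenius endomorphism of degree `d = deg_Fr(κ)` of the Frobenius-trivial `A`,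
factor `F_d ∘ φ` and `κ ∘ ψ` by Definition 1.3 (iv)(a); the Frobenius-type factors out of `B` have the
same degree `d`, hence agree up to isomorphism (Definition 1.3 (ii)), and the remaining pre-steps form an
`A`-pair for `(C', ζ ∘ Base(κ)⁻¹)` with class `d ·` class (`APair.cls_eq_pow`).
[cite: MochizukiFrdI2008, Thm. 5.1 (i) p.99] -/
theorem mk_cls_pushforward (hF : IsFrobenioid F) (hiso : IsOfIsotropicType F) {A : C}
    (hA : IsFrobeniusTrivial F A) (X : IsomOver F (baseObj F A)) {C' : C} (κ : X.obj ⟶ C')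
    (hκ : IsFrobeniusType F κ) (p p' : APair F A)
    (hp : (⟦p.toIsomOver⟧ : PicC F (baseObj F A)) = ⟦X⟧)
    (hp' : (⟦p'.toIsomOver⟧ : PicC F (baseObj F A)) = ⟦X.pushforward κ hκ.2⟧) :
    (QuotientGroup.mk p'.cls : (biratSubfunctor F).Pic (baseObj F A)) =
      QuotientGroup.mk p.cls ^ (degFr F κ : ℕ) := by
  haveI : IsIso (Base F p.fst) := p.isPreStep_fst.2
  haveI : IsIso (Base F p.snd) := p.isPreStep_snd.2
  haveI : IsIso (Base F κ) := hκ.2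
  obtain ⟨k, hk⟩ : ∃ k : p.tgt ≅ X.obj, Base F k.hom ≫ X.iso.hom = p.toIsomOver.iso.hom :=
    Quotient.exact hp
  have hkraw : Base F k.hom ≫ X.iso.hom = inv (Base F p.snd) ≫ Base F p.fst := hk
  obtain ⟨ζ, hζ⟩ := hA
  obtain ⟨hζd, hζb, hζf⟩ := hζ (degFr F κ)
  -- `κ' := k.hom ≫ κ : C → C'` is of Frobenius type, of degree `deg_Fr κ`
  have hκ' : IsFrobeniusType F (k.hom ≫ κ) :=
    ⟨⟨isCoAngular_of_isIsotropic_codomains F _ fun Z _ => hiso Z,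
      IsIsometry.comp F (isIsometry_of_isIso F hF.isPreFrobenioid _) hκ.1.2⟩,
      IsBaseIso.comp F (isBaseIso_of_isIso F _) hκ.2⟩
  haveI : IsIso (Base F (k.hom ≫ κ)) := hκ'.2
  have hdκ' : degFr F (k.hom ≫ κ) = degFr F κ := by
    rw [degFr_comp, show degFr F k.hom = 1 from isLinear_of_isIso F _, one_mul]
  -- factor `φ ≫ F_d`
  obtain ⟨X₁, Y₁, γ, β, α, hfac, hγ, hβ, hα⟩ := hF.iv_a_exists (p.fst ≫ (ζ (degFr F κ) : A ⟶ A))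
  haveI : IsIso (Base F γ) := hγ.2
  haveI : IsIso (Base F β) := hβ.2
  have hBα : IsBaseIso F α := by
    have h1 : IsIso (Base F γ ≫ Base F β ≫ Base F α) := by
      rw [← base_comp, ← base_comp, hfac, base_comp,
        show Base F (ζ (degFr F κ) : A ⟶ A) = 𝟙 _ from hζb, Category.comp_id]
      infer_instance
    haveI := h1
    haveI := IsIso.of_isIso_comp_left (Base F γ) (Base F β ≫ Base F α)
    exact IsIso.of_isIso_comp_left (Base F β) (Base F α)
  haveI : IsIso α := (isPullbackMorphism_and_isBaseIso_iff_isIso F α).mp ⟨hα, hBα⟩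
  have hφ₁ : IsPreStep F (β ≫ α) := IsPreStep.comp F hβ (isPreStep_of_isIso F α)
  have hdγ : degFr F γ = degFr F κ := by
    have e := congrArg (degFr F) hfac
    rw [degFr_comp, degFr_comp, degFr_comp, show degFr F β = 1 from hβ.1,
      show degFr F α = 1 from isLinear_of_isIso F α, mul_one, mul_one,
      show degFr F p.fst = 1 from p.isPreStep_fst.1, one_mul, hζd] at e
    exact e
  -- factor `ψ ≫ κ'`
  obtain ⟨X₂, Y₂, γ₂, β₂, α₂, hfac₂, hγ₂, hβ₂, hα₂⟩ := hF.iv_a_exists (p.snd ≫ k.hom ≫ κ)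
  haveI : IsIso (Base F γ₂) := hγ₂.2
  haveI : IsIso (Base F β₂) := hβ₂.2
  have hBα₂ : IsBaseIso F α₂ := by
    have h1 : IsIso (Base F γ₂ ≫ Base F β₂ ≫ Base F α₂) := by
      rw [← base_comp, ← base_comp, hfac₂, base_comp]
      infer_instance
    haveI := h1
    haveI := IsIso.of_isIso_comp_left (Base F γ₂) (Base F β₂ ≫ Base F α₂)
    exact IsIso.of_isIso_comp_left (Base F β₂) (Base F α₂)
  haveI : IsIso α₂ := (isPullbackMorphism_and_isBaseIso_iff_isIso F α₂).mp ⟨hα₂, hBα₂⟩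
  have hψ₁ : IsPreStep F (β₂ ≫ α₂) := IsPreStep.comp F hβ₂ (isPreStep_of_isIso F α₂)
  have hdγ₂ : degFr F γ₂ = degFr F κ := by
    have e := congrArg (degFr F) hfac₂
    rw [degFr_comp, degFr_comp, degFr_comp, show degFr F β₂ = 1 from hβ₂.1,
      show degFr F α₂ = 1 from isLinear_of_isIso F α₂, mul_one, mul_one,
      show degFr F p.snd = 1 from p.isPreStep_snd.1, one_mul, hdκ'] at e
    exact e
  -- the two Frobenius-type morphisms out of `B` agree up to isomorphism
  obtain ⟨ι, hι⟩ := hF.ii_unique γ γ₂ hγ hγ₂ (hdγ.trans hdγ₂.symm)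
  -- the new `A`-pair `r = (β ≫ α, ι ≫ β₂ ≫ α₂)` for `(C', ζ ∘ Base(κ)⁻¹)`
  let r : APair F A :=
    ⟨X₁, C', β ≫ α, ι.hom ≫ β₂ ≫ α₂, hφ₁, IsPreStep.comp F (isPreStep_of_isIso F _) hψ₁⟩
  have hpz : γ ≫ r.fst = p.fst ≫ (ζ (degFr F κ) : A ⟶ A) := hfac
  have hpk : γ ≫ r.snd = p.snd ≫ (k.hom ≫ κ) := by
    show γ ≫ ι.hom ≫ β₂ ≫ α₂ = _
    rw [← Category.assoc, hι, hfac₂]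
  have hcls : r.cls = p.cls ^ (degFr F κ : ℕ) := by
    have e := APair.cls_eq_pow F p r γ hγ (ζ (degFr F κ) : A ⟶ A) hζb hζf.1.2 hpz (k.hom ≫ κ) hκ'.1.2
      (hdκ'.trans hdγ.symm) (hζd.trans hdγ.symm) hpk
    rw [hdγ] at e
    exact e
  -- `r` represents the pushforward `(C', ζ ∘ Base(κ)⁻¹)`
  haveI : IsIso (Base F r.snd) := r.isPreStep_snd.2
  have hr : (⟦r.toIsomOver⟧ : PicC F (baseObj F A)) = ⟦X.pushforward κ hκ.2⟧ := by
    refine Quotient.sound ⟨Iso.refl C', ?_⟩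
    show Base F (𝟙 C') ≫ (inv (Base F κ) ≫ X.iso.hom) = inv (Base F r.snd) ≫ Base F r.fst
    rw [base_id, Category.id_comp, IsIso.eq_inv_comp, ← cancel_epi (Base F γ)]
    conv_lhs => rw [← Category.assoc, ← base_comp, hpk, base_comp, base_comp]
    conv_rhs => rw [← base_comp, hpz, base_comp,
      show Base F (ζ (degFr F κ) : A ⟶ A) = 𝟙 _ from hζb, Category.comp_id]
    simp only [Category.assoc, IsIso.hom_inv_id_assoc]
    rw [hkraw, IsIso.hom_inv_id_assoc]
  rw [mk_cls_eq_of_toIsomOver_eq F hF hiso (hp'.trans hr.symm), hcls, QuotientGroup.mk_pow]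

/-! ### Theorem 5.1 (i) -/

/-- **FrdI Theorem 5.1 (i), PROVED** — the named statement `Thm51i F A` of
`DivisorialDescriptions.lean` (`Ψ := Φ^birat` the concrete `biratSubfunctor`): for a Frobenioid of
isotropic type and a Frobenius-trivial `A`, the two assignments of an `A`-pair induce a bijection
`Pic_Φ(A) ⥲ Pic_C(A)`, compatible with morphisms of Frobenius type as printed.
[cite: MochizukiFrdI2008, Thm. 5.1 (i) p.96] -/
theorem thm51i_holds (A : C) : Thm51i F A :=
  ⟨fun hF hiso _ =>
    ⟨fun _ _ => ⟨toIsomOver_eq_of_mk_cls_eq F hF hiso, mk_cls_eq_of_toIsomOver_eq F hF hiso⟩,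
      fun γ => by
        obtain ⟨g, rfl⟩ := QuotientGroup.mk_surjective γ
        obtain ⟨p, hp⟩ := exists_apair_cls_eq F hF A g
        exact ⟨p, by rw [hp]⟩,
      exists_apair_toIsomOver_eq F hF A⟩,
    fun hF hiso hA X _ κ hκ p p' hp hp' => mk_cls_pushforward F hF hiso hA X κ hκ p p' hp hp'⟩

end PreFrobenioid

end Literature.AlgebraicGeometry.Frobenioids
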